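import Summits.Ventures.PercRepro.ProfilePointedContractionStep

/-!
# PercRepro — THE MOVE GRAPH ON THE CAPTURED FAMILY: THE EDGE IDENTITY AND THE BLOCKED-MOVE FORM OF THE
COLOOP LIMIT   (p10, gen 16; `proofs/P10-AVFULL.md` §24(a)–(c))

For a finite matroid `M` on `N = #E`, a point `p` and the captured `p`-avoiding family `𝒦 = capSets M p`
(`X ∈ 𝒦` iff `X` and `E ∖ X` are independent, `p ∉ X`, `p ∈ cl X`; write `Y := (E ∖ X) ∖ p` for the `p`-side
minus `p`), an element MOVES across the partition when the result is again captured: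
  UP-MOVE of `y ∈ Y` (`upMoves`):    `X ∪ y ∈ 𝒦`  iff  `y ∉ cl X`;  BLOCKED iff `y ∈ Y ∩ cl X` (`upBlocked`);
  DOWN-MOVE of `x ∈ X` (`downMoves`): `X ∖ x ∈ 𝒦`  iff  `p ∈ cl(X ∖ x)` (`x` is outside the fundamental circuit of
  `p`) and `x ∉ cl(E ∖ X)`;  BLOCKED otherwise (`downBlocked`, which contains the fundamental circuit minus `p`).
THE EDGE IDENTITY: `(X, y) ↦ (X ∪ y, y)` is a bijection from the up-moves at level `k` onto the down-moves at level
`k + 1` (`card_upMoves_filter_eq`, per element; `sum_card_upMoves_eq_sum_card_downMoves_level`, per level;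
`sum_card_upMoves_eq_sum_card_downMoves`, in total).  Counting the `N − 1 − #X` elements of `Y` and the `#X`
elements of `X` as moved-or-blocked gives THE BLOCKED-MOVE FORM OF THE COLOOP LIMIT

  `Σ_{X ∈ 𝒦} (2 #X − N)  =  Σ_{X ∈ 𝒦} (#downBlocked X − 1 − #upBlocked X)`   (`sum_capSets_signed_eq_blocked`):

(C1′) «Φ ≥ 0» says exactly that the blocked down-moves, minus one per captured set, dominate the blocked up-moves
(the R2 configurations of §23(c)).  The bounds `#upBlocked ≤ N − 1 − ρ` and `#downBlocked ≥ #fundCirc` and their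
consequences (the `p`-girth regime of (C1′), the level inequality `(ρ − k)·κ_k ≤ (k + 2 − g)·κ_{k+1}`) are in
ProfilePointedMovesBounds.  Nothing here asserts (C1′), (★), (A1κ) or (CM).
-/

open scoped Matroid

namespace PercRepro.Cogirth

open Finset ThmH Skew

variable {α : Type} [DecidableEq α] {M : Matroid α} [M.Finite]

/-! ### The four classes of elements relative to a captured set -/

/-- The up-moves of `X`: the elements `y ≠ p` of the `p`-side with `y ∉ cl X` (so `X ∪ y` is again captured). -/
noncomputable def upMoves (M : Matroid α) [M.Finite] (p : α) (X : Finset α) : Finset α :=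
  ((gr M \ X).erase p).filter (fun y => y ∉ clF M X)

/-- The blocked up-moves of `X`: the elements `y ≠ p` of the `p`-side spanned by `X`. -/
noncomputable def upBlocked (M : Matroid α) [M.Finite] (p : α) (X : Finset α) : Finset α :=
  ((gr M \ X).erase p).filter (fun y => y ∈ clF M X)

/-- The down-moves of `X`: the elements `x ∈ X` with `p ∈ cl(X ∖ x)` and `x ∉ cl(E ∖ X)` (so `X ∖ x` is again
captured). -/
noncomputable def downMoves (M : Matroid α) [M.Finite] (p : α) (X : Finset α) : Finset α :=
  X.filter (fun x => p ∈ clF M (X.erase x) ∧ x ∉ clF M (gr M \ X))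

/-- The blocked down-moves of `X`: the elements `x ∈ X` in the fundamental circuit of `p` (`p ∉ cl(X ∖ x)`) or
spanned by the `p`-side. -/
noncomputable def downBlocked (M : Matroid α) [M.Finite] (p : α) (X : Finset α) : Finset α :=
  X.filter (fun x => p ∉ clF M (X.erase x) ∨ x ∈ clF M (gr M \ X))

/-- The fundamental circuit of `p` through a captured `X`, minus `p`: the `x ∈ X` with `p ∉ cl(X ∖ x)`. -/
noncomputable def fundCirc (M : Matroid α) [M.Finite] (p : α) (X : Finset α) : Finset α :=
  X.filter (fun x => p ∉ clF M (X.erase x))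

omit [DecidableEq α] in
/-- Membership in `clF` is membership in the closure. -/
theorem mem_clF_iff {S : Finset α} {x : α} : x ∈ clF M S ↔ x ∈ M.closure (S : Set α) := by
  rw [← coe_clF]
  exact mem_coe.symm

/-- A bi-independent finset is independent. -/
theorem indep_of_mem_biIndepAll {X : Finset α} (hX : X ∈ biIndepAll M) : M.Indep (X : Set α) :=
  indep_of_rk_eq_card' (mem_biIndepAll.1 hX).2.1

/-- The complement of a bi-independent finset is independent. -/
theorem indep_sdiff_of_mem_biIndepAll {X : Finset α} (hX : X ∈ biIndepAll M) :
    M.Indep ((gr M \ X : Finset α) : Set α) :=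
  indep_of_rk_eq_card' (mem_biIndepAll.1 hX).2.2

/-- An element of an independent finset is not spanned by the rest. -/
theorem notMem_clF_erase_of_indep {Z : Finset α} (hZ : M.Indep (Z : Set α)) {y : α} (hy : y ∈ Z) :
    y ∉ clF M (Z.erase y) := by
  rw [mem_clF_iff, coe_erase]
  exact hZ.notMem_closure_sdiff_of_mem (by exact_mod_cast hy)

/-- `#upMoves + #upBlocked = #Y`. -/
theorem card_upMoves_add_card_upBlocked (p : α) (X : Finset α) :
    (upMoves M p X).card + (upBlocked M p X).card = ((gr M \ X).erase p).card := by
  unfold upMoves upBlocked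
  rw [add_comm]
  exact card_filter_add_card_filter_not _

/-- `downBlocked` is the complement of `downMoves` inside `X`. -/
theorem downBlocked_eq (p : α) (X : Finset α) :
    downBlocked M p X = X.filter (fun x => ¬ (p ∈ clF M (X.erase x) ∧ x ∉ clF M (gr M \ X))) := by
  unfold downBlocked
  apply filter_congr
  intro x _
  tauto

/-- `#downMoves + #downBlocked = #X`. -/
theorem card_downMoves_add_card_downBlocked (p : α) (X : Finset α) :
    (downMoves M p X).card + (downBlocked M p X).card = X.card := by
  rw [downBlocked_eq]
  unfold downMoves
  exact card_filter_add_card_filter_not _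

/-- The fundamental circuit minus `p` consists of blocked down-moves. -/
theorem fundCirc_subset_downBlocked (p : α) (X : Finset α) : fundCirc M p X ⊆ downBlocked M p X := by
  intro x hx
  unfold fundCirc at hx
  unfold downBlocked
  rw [mem_filter] at hx ⊢
  exact ⟨hx.1, Or.inl hx.2⟩

/-- `#Y + #X + 1 = N` for a captured `X`. -/
theorem card_pSide_add {p : α} (hp : p ∈ gr M) {X : Finset α} (hX : X ∈ capSets M p) :
    ((gr M \ X).erase p).card + X.card + 1 = (gr M).card := by
  obtain ⟨⟨hXb, hpX⟩, -⟩ := mem_capSets.1 hX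
  have hXg : X ⊆ gr M := (mem_biIndepAll.1 hXb).1
  have hpZ : p ∈ gr M \ X := mem_sdiff.2 ⟨hp, hpX⟩
  have hlt : X.card < (gr M).card := card_lt_card ((ssubset_iff_of_subset hXg).2 ⟨p, hp, hpX⟩)
  rw [card_erase_of_mem hpZ, card_sdiff_of_subset hXg]
  omega

/-! ### The edge bijection `(X, y) ↦ (X ∪ y, y)` -/

/-- **THE EDGE BIJECTION, PER ELEMENT**: for `y ∈ E`, `X ↦ X ∪ y` maps the level-`k` captured sets with `y` an
up-move onto the level-`(k+1)` captured sets with `y` a down-move. -/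
theorem card_upMoves_filter_eq (p : α) {y : α} (hy : y ∈ gr M) (k : ℕ) :
    (((capSets M p).filter (fun X => X.card = k)).filter (fun X => y ∈ upMoves M p X)).card =
      (((capSets M p).filter (fun X => X.card = k + 1)).filter (fun X => y ∈ downMoves M p X)).card := by
  apply card_bij (fun X _ => insert y X)
  · intro X hX
    rw [mem_filter, mem_filter] at hX
    obtain ⟨⟨hXc, hXk⟩, hyu⟩ := hX
    unfold upMoves at hyu
    rw [mem_filter, mem_erase, mem_sdiff] at hyu
    obtain ⟨⟨hyp, -, hyX⟩, hycl⟩ := hyu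
    obtain ⟨⟨hXb, hpX⟩, hpcl⟩ := mem_capSets.1 hXc
    have hins : insert y X ∈ biIndepAll M := (insert_mem_biIndepAll_iff hXb hy hyX).2 hycl
    have hZ : M.Indep ((gr M \ X : Finset α) : Set α) := indep_sdiff_of_mem_biIndepAll hXb
    have hyZ : y ∈ gr M \ X := mem_sdiff.2 ⟨hy, hyX⟩
    rw [mem_filter, mem_filter, mem_capSets]
    refine ⟨⟨⟨⟨hins, ?_⟩, mem_clF_of_subset (subset_insert y X) hpcl⟩, ?_⟩, ?_⟩
    · rw [mem_insert, not_or]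
      exact ⟨fun h => hyp h.symm, hpX⟩
    · rw [card_insert_of_notMem hyX, hXk]
    · unfold downMoves
      rw [mem_filter, erase_insert hyX, sdiff_insert]
      exact ⟨mem_insert_self y X, hpcl, notMem_clF_erase_of_indep hZ hyZ⟩
  · intro X₁ hX₁ X₂ hX₂ h
    have h1 : y ∉ X₁ := by
      have := (mem_filter.1 hX₁).2
      unfold upMoves at this
      rw [mem_filter, mem_erase, mem_sdiff] at this
      exact this.1.2.2
    have h2 : y ∉ X₂ := by
      have := (mem_filter.1 hX₂).2
      unfold upMoves at this
      rw [mem_filter, mem_erase, mem_sdiff] at this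
      exact this.1.2.2
    rw [← erase_insert h1, ← erase_insert h2, h]
  · intro X' hX'
    rw [mem_filter, mem_filter] at hX'
    obtain ⟨⟨hXc, hXk⟩, hyd⟩ := hX'
    unfold downMoves at hyd
    rw [mem_filter] at hyd
    obtain ⟨hyX, hpcl, hycl⟩ := hyd
    obtain ⟨⟨hXb, hpX⟩, -⟩ := mem_capSets.1 hXc
    have hXe : X'.erase y ∈ biIndepAll M := (erase_mem_biIndepAll_iff hXb hyX).2 hycl
    have hXi : M.Indep (X' : Set α) := indep_of_mem_biIndepAll hXb
    refine ⟨X'.erase y, ?_, insert_erase hyX⟩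
    rw [mem_filter, mem_filter, mem_capSets]
    refine ⟨⟨⟨⟨hXe, fun h => hpX (mem_of_mem_erase h)⟩, hpcl⟩, ?_⟩, ?_⟩
    · rw [card_erase_of_mem hyX, hXk]
      rfl
    · unfold upMoves
      rw [mem_filter, mem_erase, mem_sdiff]
      exact ⟨⟨fun h => hpX (h ▸ hyX), hy, notMem_erase y X'⟩, notMem_clF_erase_of_indep hXi hyX⟩

/-- The up-moves of a captured set lie in the ground set. -/
theorem upMoves_subset_gr (p : α) (X : Finset α) : upMoves M p X ⊆ gr M := by
  intro y hy
  unfold upMoves at hy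
  rw [mem_filter, mem_erase, mem_sdiff] at hy
  exact hy.1.2.1

/-- The down-moves of a captured set lie in the ground set. -/
theorem downMoves_subset_gr {p : α} {X : Finset α} (hX : X ∈ capSets M p) : downMoves M p X ⊆ gr M := by
  intro x hx
  unfold downMoves at hx
  rw [mem_filter] at hx
  exact (mem_biIndepAll.1 (mem_capSets.1 hX).1.1).1 hx.1

/-- **THE EDGE IDENTITY, PER LEVEL**: the up-moves at level `k` and the down-moves at level `k + 1` are
equinumerous. -/
theorem sum_card_upMoves_eq_sum_card_downMoves_level (p : α) (k : ℕ) :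
    ∑ X ∈ (capSets M p).filter (fun X => X.card = k), (upMoves M p X).card =
      ∑ X ∈ (capSets M p).filter (fun X => X.card = k + 1), (downMoves M p X).card := by
  have h1 : ∀ X ∈ (capSets M p).filter (fun X => X.card = k),
      (upMoves M p X).card = ((gr M).filter (fun y => y ∈ upMoves M p X)).card := by
    intro X _
    rw [filter_mem_eq_inter, inter_eq_right.2 (upMoves_subset_gr p X)]
  have h2 : ∀ X ∈ (capSets M p).filter (fun X => X.card = k + 1),
      (downMoves M p X).card = ((gr M).filter (fun y => y ∈ downMoves M p X)).card := by
    intro X hX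
    rw [filter_mem_eq_inter, inter_eq_right.2 (downMoves_subset_gr (mem_filter.1 hX).1)]
  rw [sum_congr rfl h1, sum_congr rfl h2,
    ← sum_card_filter_comm (gr M) _ (fun y X => y ∈ upMoves M p X),
    ← sum_card_filter_comm (gr M) _ (fun y X => y ∈ downMoves M p X)]
  exact sum_congr rfl (fun y hy => card_upMoves_filter_eq p hy k)

/-- The empty set has no down-moves. -/
theorem downMoves_empty (p : α) : downMoves M p (∅ : Finset α) = ∅ := by
  unfold downMoves
  exact filter_empty _

/-- **THE EDGE IDENTITY**: the up-moves and the down-moves of the captured family are equinumerous. -/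
theorem sum_card_upMoves_eq_sum_card_downMoves (p : α) :
    ∑ X ∈ capSets M p, (upMoves M p X).card = ∑ X ∈ capSets M p, (downMoves M p X).card := by
  have hcard : ∀ X ∈ capSets M p, X.card ≤ (gr M).card := fun X hX =>
    card_le_card (mem_biIndepAll.1 (mem_capSets.1 hX).1.1).1
  rw [← sum_fiberwise_of_maps_to (s := capSets M p) (t := range ((gr M).card + 1)) (g := fun X => X.card)
    (fun X hX => mem_range.2 (Nat.lt_succ_of_le (hcard X hX))),
    ← sum_fiberwise_of_maps_to (s := capSets M p) (t := range ((gr M).card + 2)) (g := fun X => X.card)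
    (fun X hX => mem_range.2 (by have := hcard X hX; omega)),
    sum_range_succ' (fun j => ∑ X ∈ (capSets M p).filter (fun X => X.card = j), (downMoves M p X).card)
      ((gr M).card + 1)]
  have h0 : ∑ X ∈ (capSets M p).filter (fun X => X.card = 0), (downMoves M p X).card = 0 := by
    apply sum_eq_zero
    intro X hX
    rw [mem_filter, card_eq_zero] at hX
    rw [hX.2, downMoves_empty, card_empty]
  rw [h0, add_zero]
  exact sum_congr rfl (fun k _ => sum_card_upMoves_eq_sum_card_downMoves_level p k)

/-! ### The blocked-move form of the coloop limit -/

/-- **THE BLOCKED-MOVE FORM OF THE COLOOP LIMIT**: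
`Σ_{X ∈ 𝒦} (2 #X − N) = Σ_{X ∈ 𝒦} (#downBlocked X − 1 − #upBlocked X)`. -/
theorem sum_capSets_signed_eq_blocked {p : α} (hp : p ∈ gr M) :
    ∑ X ∈ capSets M p, (2 * (X.card : ℤ) - (gr M).card) =
      ∑ X ∈ capSets M p, (((downBlocked M p X).card : ℤ) - 1 - (upBlocked M p X).card) := by
  have hpt : ∀ X ∈ capSets M p, (2 * (X.card : ℤ) - (gr M).card) =
      (((downMoves M p X).card : ℤ) + (downBlocked M p X).card) -
        (((upMoves M p X).card : ℤ) + (upBlocked M p X).card) - 1 := by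
    intro X hX
    have h1 : ((upMoves M p X).card : ℤ) + (upBlocked M p X).card = ((gr M \ X).erase p).card := by
      exact_mod_cast card_upMoves_add_card_upBlocked (M := M) p X
    have h2 : ((downMoves M p X).card : ℤ) + (downBlocked M p X).card = X.card := by
      exact_mod_cast card_downMoves_add_card_downBlocked (M := M) p X
    have h3 : (((gr M \ X).erase p).card : ℤ) + X.card + 1 = (gr M).card := by
      exact_mod_cast card_pSide_add hp hX
    linarith
  rw [sum_congr rfl hpt]
  have hud : ∑ X ∈ capSets M p, ((downMoves M p X).card : ℤ) =
      ∑ X ∈ capSets M p, ((upMoves M p X).card : ℤ) := by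
    exact_mod_cast (sum_card_upMoves_eq_sum_card_downMoves (M := M) p).symm
  simp only [sum_sub_distrib, sum_add_distrib]
  rw [hud]
  ring

end PercRepro.Cogirth
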